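import Literature.Barriers.CriticalPhenomena.PositionSpaceRGNonGibbsianIsraelGeometry
import HarnessLib

/-!
# Israel's example (van Enter–Fernández–Sokal 1993, §4.1.2): admissible boundary conditions and
# the sign of the effective fields (Step 2 (i)–(ii))

Companion file of `PositionSpaceRGNonGibbsianIsraelGeometry.lean`. The internal-spin systems of
Steps 2–3 have all image spins of `Λ_{2n+2}` frozen: `±ω'_alt` on `Λ_{2n}` (the `+` pattern with
the origin frozen `+`, or the global flip of the `-` pattern, footnote 48) and `+1` on the
annulus `Γ_{2n+2}`; everything outside `Λ_{2n+2}` is arbitrary. Such boundary conditions are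
`IsAdmissibleBC n ε ζ`. The content of Step 2 (i)–(ii) and Step 1 ("each internal spin is adjacent
either to two image spins of opposite sign — in which case the effective magnetic fields cancel —
or else to no image spin"; "(i) An internal spin in layer `Γ_{R+1}` feels an effective field `+2J`
if it is adjacent to two `+` image spins. (ii) An internal spin in layer `Γ_{R+2}` feels an
effective field `+3J` or `+J`") is the sitewise inequality `frozenField_box_le_frozenField`: the
effective field of an admissible boundary condition at an internal site dominates the field of the
reduced system (`+J` on layer `Γ^int_{2n+2}`, `0` elsewhere).

## What is formalised (namespace `Literature.Barriers.CriticalPhenomena.NonGibbs`)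

`IsAdmissibleBC`, `altConfig_add_vec`, `halve_add_vec_eq`, the neighbour bookkeeping
(`nbr_mem_box_iff`, `isImageSite_nbr_iff`) and `frozenField_box_le_frozenField`. All proved; no
named facts.
-/

noncomputable section

namespace Literature.Barriers.CriticalPhenomena.NonGibbs

open Finset Literature.Probability.LatticeModels Literature.Probability.LatticeModels.AEdge

/-! ### IsAdmissibleBC boundary conditions and the sign of the effective fields -/

/-- **IsAdmissibleBC boundary conditions of sign `ε`**: the image spins of `Λ_{2n+2}` are `ε ω'_alt`
on `Λ_{2n}` (in image coordinates: `ζ_z = ε (-1)^{|z/2|}`) and `+1` on the annulus `Γ_{2n+2}`;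
all other spins (internal, or outside the box) arbitrary. For `ε = +1` these are the boundary
conditions of the `+`-pattern system of Step 3 with the image spin at the origin frozen to
`+ = ω'_alt(0)`; for `ε = -1`, the global spin flips of those of the `-`-pattern system (origin
frozen to `-`, footnote 48). [cite: VanenterFernandezSokal1993, §4.1.2 Steps 2–3 and footnote 48] -/
def IsAdmissibleBC (n : ℕ) (ε : ℤˣ) (ζ : SpinConfig (Site 2)) : Prop :=
  ∀ z : Site 2, z ∈ box 2 (2 * n + 2) → IsImageSite z →
    (z ∈ box 2 (2 * n) → ζ z = ε * altConfig 2 (halve z)) ∧ (z ∉ box 2 (2 * n) → ζ z = 1)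

/-- `ω'_alt` alternates along lattice directions: `ω'_alt(x + eᵢ) = -ω'_alt(x)`.
[cite: VanenterFernandezSokal1993, eq. (4.2)] -/
theorem altConfig_add_vec (x : Site 2) (i : Fin 2) :
    altConfig 2 (x + vec i) = -altConfig 2 x := by
  simp only [altConfig_apply, Fin.sum_univ_two, Pi.add_apply]
  have h0 : vec i 0 + vec i 1 = 1 := by
    fin_cases i <;> simp
  have h : x 0 + vec i 0 + (x 1 + vec i 1) = (x 0 + x 1) + 1 := by linarith
  rw [h, uzpow_add, uzpow_one, mul_neg_one]

/-- For a midpoint `y` (odd coordinate `i`), its two neighbours `y ± eᵢ` have image coordinates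
differing by `eᵢ`. [cite: VanenterFernandezSokal1993, §4.1.2 Step 1] -/
theorem halve_add_vec_eq {y : Site 2} {i : Fin 2} (hi : Odd (y i)) :
    halve (y + vec i) = halve (y - vec i) + vec i := by
  funext j
  by_cases hj : j = i
  · subst hj
    simp only [halve, Pi.add_apply, Pi.sub_apply, vec_apply_same]
    obtain ⟨k, hk⟩ := hi
    omega
  · simp only [halve, Pi.add_apply, Pi.sub_apply, vec_apply_ne hj]
    simp

/-- The spins `±1` as real numbers are `≥ -1`. [cite: FriedliVelenik2017, §3.1] -/
theorem neg_one_le_spinAt (z : Site 2) (σ : SpinConfig (Site 2)) : -1 ≤ spinAt z σ := by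
  rcases spinAt_eq_one_or_eq_neg_one z σ with h | h
  · rw [h]; norm_num
  · rw [h]

/-- The real value of a spin. [cite: FriedliVelenik2017, §3.1] -/
theorem spinAt_eq_cast (z : Site 2) (σ : SpinConfig (Site 2)) : spinAt z σ = ((σ z : ℤ) : ℝ) := rfl

/-- Quantifying over the two coordinates through a pair of distinct indices. [folklore] -/
theorem forall_fin_two_iff_of_ne {i j : Fin 2} (hij : i ≠ j) (P : Fin 2 → Prop) :
    (∀ k, P k) ↔ P i ∧ P j := by
  fin_cases i <;> fin_cases j <;> simp_all [Fin.forall_fin_two, and_comm]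

/-- Summing over the two coordinates through a pair of distinct indices. [folklore] -/
theorem sum_fin_two_eq_of_ne {i j : Fin 2} (hij : i ≠ j) (f : Fin 2 → ℝ) :
    ∑ k, f k = f i + f j := by
  fin_cases i <;> fin_cases j <;> simp_all [Fin.sum_univ_two, add_comm]

/-- Coordinates of the neighbour `y + s eᵢ`: the `i`-th moves by `s`. [folklore] -/
theorem nbr_apply_same (y : Site 2) (i : Fin 2) (s : ℤ) : (y + s • vec i) i = y i + s := by
  simp

/-- Coordinates of the neighbour `y + s eᵢ`: the other one is unchanged. [folklore] -/
theorem nbr_apply_ne (y : Site 2) {i j : Fin 2} (hj : j ≠ i) (s : ℤ) : (y + s • vec i) j = y j := by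
  simp [vec_apply_ne hj]

/-- For a site of the box `Λ_{2n+2}`, the neighbour `y + s eᵢ` (`s = ±1`) leaves the box exactly
when `y_i = s (2n+2)`. [cite: VanenterFernandezSokal1993, §4.1.2 Step 2 (ii)] -/
theorem nbr_mem_box_iff {n : ℕ} {y : Site 2} (hy : y ∈ box 2 (2 * n + 2)) (i : Fin 2) {s : ℤ}
    (hs : s = 1 ∨ s = -1) :
    y + s • vec i ∈ box 2 (2 * n + 2) ↔ y i ≠ s * (2 * n + 2) := by
  rw [mem_box] at hy ⊢
  constructor
  · intro h heq
    have := h i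
    rw [nbr_apply_same] at this
    rcases hs with rfl | rfl <;> push_cast at this heq <;> omega
  · intro hne k
    by_cases hk : k = i
    · subst hk
      rw [nbr_apply_same]
      have := hy k
      rcases hs with rfl | rfl <;> push_cast at hne ⊢ <;> omega
    · rw [nbr_apply_ne y hk]
      exact hy k

/-- The neighbour `y + s eᵢ` (`s = ±1`) is an image site iff `y_i` is odd and the other coordinate
is even (`y` is a midpoint along `i`). [cite: VanenterFernandezSokal1993, §4.1.2 Step 1] -/
theorem isImageSite_nbr_iff (y : Site 2) {i j : Fin 2} (hij : i ≠ j) {s : ℤ} (hs : s = 1 ∨ s = -1) :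
    IsImageSite (y + s • vec i) ↔ Odd (y i) ∧ Even (y j) := by
  have hiff : IsImageSite (y + s • vec i) ↔ ∀ k, Even ((y + s • vec i) k) := by
    simp [IsImageSite, Fin.forall_fin_two]
  rw [hiff, forall_fin_two_iff_of_ne hij, nbr_apply_same, nbr_apply_ne y (Ne.symm hij)]
  have hodd : Odd s := by rcases hs with rfl | rfl <;> decide
  constructor
  · rintro ⟨h1, h2⟩
    refine ⟨?_, h2⟩
    by_contra hno
    rw [Int.not_odd_iff_even] at hno
    exact Int.not_odd_iff_even.2 h1 (hno.add_odd hodd)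
  · rintro ⟨h1, h2⟩
    exact ⟨h1.add_odd hodd, h2⟩

/-- A non-image site is internal iff it lies in the box. [cite: VanenterFernandezSokal1993, §4.1.2 Step 2] -/
theorem mem_internalVolume_iff_of_not_isImageSite {n : ℕ} {z : Site 2} (hz : ¬ IsImageSite z) :
    z ∈ internalVolume n ↔ z ∈ box 2 (2 * n + 2) := by
  rw [mem_internalVolume_iff]
  exact ⟨fun h => h.1, fun h => ⟨h, hz⟩⟩

/-- **The effective fields cancel inside and are nonnegative at the boundary** (Step 2 (i)–(ii)
and Step 1: "each internal spin is adjacent either to two image spins of opposite sign — in which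
case the effective magnetic fields cancel — or else to no image spin"): for an admissible boundary
condition `ζ` and every internal site `y ∈ W'_n`, the field `∑_{z ∼ y, z ∉ W'_n} ζ_z` exerted by the
frozen spins is at least the field `#{z ∼ y : z ∉ Λ_{2n+2}}` (`= +1` on layer `Γ_{2n+2}`, `0`
elsewhere) of the reduced system. [cite: VanenterFernandezSokal1993, §4.1.2 Step 1 and Step 2 (i)–(ii)] -/
theorem frozenField_box_le_frozenField {n : ℕ} {ε : ℤˣ} {ζ : SpinConfig (Site 2)}
    (hζ : IsAdmissibleBC n ε ζ) {y : Site 2} (hy : y ∈ internalVolume n) :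
    frozenField (· ∈ box 2 (2 * n + 2)) (fun _ => (1 : ℝ)) y ≤
      frozenField (· ∈ internalVolume n) (fun z => spinAt z ζ) y := by
  classical
  obtain ⟨hyb, hyi⟩ := mem_internalVolume_iff.1 hy
  -- the terms of the two fields, for the neighbour `y + s eᵢ`
  set qt : ℤ → Fin 2 → ℝ := fun s i => if y + s • vec i ∈ box 2 (2 * n + 2) then 0 else 1 with hqt
  set ft : ℤ → Fin 2 → ℝ := fun s i =>
    if y + s • vec i ∈ internalVolume n then 0 else spinAt (y + s • vec i) ζ with hft
  have hsub : ∀ i : Fin 2, y - vec i = y + (-1 : ℤ) • vec i := fun i => by simp [sub_eq_add_neg]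
  have hL : frozenField (· ∈ box 2 (2 * n + 2)) (fun _ => (1 : ℝ)) y = ∑ i, (qt 1 i + qt (-1) i) := by
    simp only [frozenField, hqt, one_smul, hsub]
  have hR : frozenField (· ∈ internalVolume n) (fun z => spinAt z ζ) y =
      ∑ i, (ft 1 i + ft (-1) i) := by
    simp only [frozenField, hft, one_smul, hsub]
  rw [hL, hR]
  have hs1 : (1 : ℤ) = 1 ∨ (1 : ℤ) = -1 := Or.inl rfl
  have hs2 : (-1 : ℤ) = 1 ∨ (-1 : ℤ) = -1 := Or.inr rfl
  have hε : ((ε : ℤ) : ℝ) = 1 ∨ ((ε : ℤ) : ℝ) = -1 := by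
    rcases Int.units_eq_one_or ε with h | h <;> simp [h]
  -- (P1) midpoint along `i`: the two image neighbours, fields `≥ 0`, and `= 2` on the top layer
  have P1 : ∀ i j : Fin 2, i ≠ j → Odd (y i) → Even (y j) →
      qt 1 i + qt (-1) i = 0 ∧ 0 ≤ ft 1 i + ft (-1) i ∧
        (|y j| = 2 * n + 2 → ft 1 i + ft (-1) i = 2) := by
    intro i j hij hi hj
    have hbox : ∀ {s : ℤ}, (s = 1 ∨ s = -1) → y + s • vec i ∈ box 2 (2 * n + 2) := by
      intro s hs
      rw [nbr_mem_box_iff hyb i hs]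
      obtain ⟨k, hk⟩ := hi
      rcases hs with rfl | rfl <;> omega
    have himg : ∀ {s : ℤ}, (s = 1 ∨ s = -1) → IsImageSite (y + s • vec i) := fun hs =>
      (isImageSite_nbr_iff y hij hs).2 ⟨hi, hj⟩
    have hval : ∀ {s : ℤ}, (s = 1 ∨ s = -1) → ft s i = spinAt (y + s • vec i) ζ := by
      intro s hs
      have : y + s • vec i ∉ internalVolume n := fun h => (mem_internalVolume_iff.1 h).2 (himg hs)
      simp only [hft]
      rw [if_neg this]
    have hq : ∀ {s : ℤ}, (s = 1 ∨ s = -1) → qt s i = 0 := fun hs => by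
      simp only [hqt]
      rw [if_pos (hbox hs)]
    -- the frozen values
    have hin : ∀ {s : ℤ}, (s = 1 ∨ s = -1) → y + s • vec i ∈ box 2 (2 * n) →
        spinAt (y + s • vec i) ζ = ((ε : ℤ) : ℝ) * spinAt (halve (y + s • vec i)) (altConfig 2) := by
      intro s hs h
      rw [spinAt_eq_cast, ((hζ _ (hbox hs) (himg hs)).1 h), Units.val_mul, Int.cast_mul]
      rfl
    have hout : ∀ {s : ℤ}, (s = 1 ∨ s = -1) → y + s • vec i ∉ box 2 (2 * n) →
        spinAt (y + s • vec i) ζ = 1 := by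
      intro s hs h
      rw [spinAt_eq_cast, ((hζ _ (hbox hs) (himg hs)).2 h), Units.val_one, Int.cast_one]
    have halt : spinAt (halve (y + (1 : ℤ) • vec i)) (altConfig 2) =
        -spinAt (halve (y + (-1 : ℤ) • vec i)) (altConfig 2) := by
      have h1 : y + (1 : ℤ) • vec i = y + vec i := by simp
      have h2 : y + (-1 : ℤ) • vec i = y - vec i := by simp [sub_eq_add_neg]
      rw [h1, h2, halve_add_vec_eq hi, spinAt_eq_cast, spinAt_eq_cast, altConfig_add_vec,
        Units.val_neg, Int.cast_neg]
    refine ⟨by rw [hq hs1, hq hs2, add_zero], ?_, fun htop => ?_⟩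
    · rw [hval hs1, hval hs2]
      by_cases hp : y + (1 : ℤ) • vec i ∈ box 2 (2 * n) <;>
        by_cases hm : y + (-1 : ℤ) • vec i ∈ box 2 (2 * n)
      · rw [hin hs1 hp, hin hs2 hm, halt]; ring_nf; exact le_rfl
      · rw [hin hs1 hp, hout hs2 hm]
        rcases hε with h | h <;> rw [h] <;>
          rcases spinAt_eq_one_or_eq_neg_one (halve (y + (1 : ℤ) • vec i)) (altConfig 2)
            with h' | h' <;> rw [h'] <;> norm_num
      · rw [hout hs1 hp, hin hs2 hm]
        rcases hε with h | h <;> rw [h] <;>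
          rcases spinAt_eq_one_or_eq_neg_one (halve (y + (-1 : ℤ) • vec i)) (altConfig 2)
            with h' | h' <;> rw [h'] <;> norm_num
      · rw [hout hs1 hp, hout hs2 hm]; norm_num
    · have hnot : ∀ {s : ℤ}, (s = 1 ∨ s = -1) → y + s • vec i ∉ box 2 (2 * n) := by
        intro s _ h
        rw [mem_box] at h
        have := h j
        rw [nbr_apply_ne y (Ne.symm hij)] at this
        rcases le_or_gt 0 (y j) with h0 | h0
        · rw [abs_of_nonneg h0] at htop; push_cast at this; omega
        · rw [abs_of_neg h0] at htop; push_cast at this; omega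
      rw [hval hs1, hval hs2, hout hs1 (hnot hs1), hout hs2 (hnot hs2)]
      norm_num
  -- (P2) centre: both neighbours along `i` are internal midpoints
  have P2 : ∀ i j : Fin 2, i ≠ j → Odd (y i) → Odd (y j) →
      qt 1 i + qt (-1) i = 0 ∧ ft 1 i + ft (-1) i = 0 := by
    intro i j hij hi hj
    have hbox : ∀ {s : ℤ}, (s = 1 ∨ s = -1) → y + s • vec i ∈ box 2 (2 * n + 2) := by
      intro s hs
      rw [nbr_mem_box_iff hyb i hs]
      obtain ⟨k, hk⟩ := hi
      rcases hs with rfl | rfl <;> omega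
    have hint : ∀ {s : ℤ}, (s = 1 ∨ s = -1) → y + s • vec i ∈ internalVolume n := by
      intro s hs
      refine mem_internalVolume_iff.2 ⟨hbox hs, fun himg => ?_⟩
      exact (Int.not_even_iff_odd.2 hj) ((isImageSite_nbr_iff y hij hs).1 himg).2
    constructor
    · simp only [hqt]
      rw [if_pos (hbox hs1), if_pos (hbox hs2), add_zero]
    · simp only [hft]
      rw [if_pos (hint hs1), if_pos (hint hs2), add_zero]
  -- (P3) even coordinate `i`, odd `j`: no image neighbours along `i`; at most one neighbour leaves
  --      the box, only on the layer `|y_i| = 2n+2`, and contributes `ζ ≥ -1` against `1`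
  have P3 : ∀ i j : Fin 2, i ≠ j → Even (y i) → Odd (y j) →
      qt 1 i + qt (-1) i ≤ 1 ∧ -(qt 1 i + qt (-1) i) ≤ ft 1 i + ft (-1) i ∧
        (qt 1 i + qt (-1) i ≠ 0 → |y i| = 2 * n + 2) := by
    intro i j hij hi hj
    have hnimg : ∀ {s : ℤ}, (s = 1 ∨ s = -1) → ¬ IsImageSite (y + s • vec i) := fun hs h =>
      (Int.not_odd_iff_even.2 hi) ((isImageSite_nbr_iff y hij hs).1 h).1
    have hper : ∀ {s : ℤ}, (s = 1 ∨ s = -1) →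
        (qt s i = if y i = s * (2 * n + 2) then 1 else 0) ∧ -qt s i ≤ ft s i := by
      intro s hs
      have hb := nbr_mem_box_iff hyb i hs (s := s)
      simp only [hqt, hft]
      by_cases h : y i = s * (2 * n + 2)
      · have hnb : y + s • vec i ∉ box 2 (2 * n + 2) := fun hb' => (hb.1 hb') h
        have hni : y + s • vec i ∉ internalVolume n := fun h' => hnb (mem_internalVolume_iff.1 h').1
        rw [if_neg hnb, if_neg hni, if_pos h]
        exact ⟨rfl, neg_one_le_spinAt _ _⟩
      · have hb' : y + s • vec i ∈ box 2 (2 * n + 2) := hb.2 h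
        have hi' : y + s • vec i ∈ internalVolume n :=
          (mem_internalVolume_iff_of_not_isImageSite (hnimg hs)).2 hb'
        rw [if_pos hb', if_pos hi', if_neg h, neg_zero]
        exact ⟨rfl, le_rfl⟩
    obtain ⟨q1, f1⟩ := hper hs1
    obtain ⟨q2, f2⟩ := hper hs2
    rw [one_mul] at q1
    rw [neg_one_mul] at q2
    have hpos : (0 : ℤ) < 2 * n + 2 := by positivity
    refine ⟨?_, by linarith, fun hne => ?_⟩
    · rw [q1, q2]
      by_cases h1 : y i = 2 * n + 2
      · have h2 : ¬ y i = -(2 * n + 2) := by rw [h1]; linarith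
        rw [if_pos h1, if_neg h2]; norm_num
      · by_cases h2 : y i = -(2 * n + 2)
        · rw [if_neg h1, if_pos h2]; norm_num
        · rw [if_neg h1, if_neg h2]; norm_num
    · rw [q1, q2] at hne
      by_cases h1 : y i = 2 * n + 2
      · rw [h1, abs_of_pos hpos]
      · by_cases h2 : y i = -(2 * n + 2)
        · rw [h2, abs_neg, abs_of_pos hpos]
        · rw [if_neg h1, if_neg h2, add_zero] at hne
          exact absurd rfl hne
  -- assembly by the type of `y`
  have h01 : (0 : Fin 2) ≠ 1 := by decide
  have h10 : (1 : Fin 2) ≠ 0 := by decide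
  rcases Int.even_or_odd (y 0) with e0 | o0 <;> rcases Int.even_or_odd (y 1) with e1 | o1
  · exact absurd ⟨e0, e1⟩ hyi
  · -- midpoint along `1`
    obtain ⟨qa, fa, ta⟩ := P1 1 0 h10 o1 e0
    obtain ⟨qb, fb, tb⟩ := P3 0 1 h01 e0 o1
    rw [Fin.sum_univ_two, Fin.sum_univ_two, qa, add_zero]
    by_cases hq : qt 1 0 + qt (-1) 0 = 0
    · rw [hq]; rw [hq, neg_zero] at fb; linarith
    · have := ta (tb hq); linarith
  · -- midpoint along `0`
    obtain ⟨qa, fa, ta⟩ := P1 0 1 h01 o0 e1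
    obtain ⟨qb, fb, tb⟩ := P3 1 0 h10 e1 o0
    rw [Fin.sum_univ_two, Fin.sum_univ_two, qa, zero_add]
    by_cases hq : qt 1 1 + qt (-1) 1 = 0
    · rw [hq]; rw [hq, neg_zero] at fb; linarith
    · have := ta (tb hq); linarith
  · -- centre
    obtain ⟨qa, fa⟩ := P2 0 1 h01 o0 o1
    obtain ⟨qb, fb⟩ := P2 1 0 h10 o1 o0
    rw [Fin.sum_univ_two, Fin.sum_univ_two, qa, qb, fa, fb]

end Literature.Barriers.CriticalPhenomena.NonGibbs

end
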